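import Mathlib
import HarnessLib
import Summits.Ventures.LatticeQCDFlow.Scoring.GeometricEnvelopeBlockSumMoments
import Summits.Ventures.LatticeQCDFlow.Scoring.SplitChainFreshPairMoments

/-!
# The sample variance of a bounded observable is `√N`-consistent from any start:
# `E|v̂_N − Var_π f| ≤ 12 √10 C² A / ((1 − ρ) √N)` under a geometric envelope

HONEST FRAMING: exact (Metropolis-corrected) sampling algorithms for lattice gauge theory;
figures of merit are autocorrelation/cost numbers at stated couplings and volumes; no
continuum-physics claim.

Venture `LatticeQCDFlow` (cell pub-lqcd), topic `Scoring`; FANOUT row 4 (`s0-u1-b`, GEN-30).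
NEW WORK of the cell, not a published result; no definition is introduced; nothing is cited as a
fact.  The denominator of the reported `τ̂_int = σ̂² / (2 v̂)` is the sample variance
`v̂_N = (1/N) Σ_{t<N} f(X_t)² − ((1/N) Σ_{t<N} f(X_t))²` of the `N` measurements.  From the cell's
block-sum second moment under the envelope
(`Scoring/GeometricEnvelopeBlockSumMoments.chain_blockSum_sq_le_of_envelope`:
`E_{μ₀}(Σ_{t<N} (g(X_t) − πg))² ≤ 10 (4 C_g A/(1−ρ))² N` for every bounded `g` and every start) and
Jensen, time averages are `√N`-consistent in `L¹`, hence so is `v̂_N` (apply it to `f` and `f²`;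
`|m̂² − (πf)²| ≤ 2C |m̂ − πf|`).  Consequently, along `N_n = b_n a_n` with `a_n, b_n → ∞`,
`√a_n (v̂_{N_n} − Var_π f) → 0` in probability (the bound is `O(1/√b_n)`): at the `√a` scale of the
batch-means CLT the denominator of `τ̂_int` is deterministic (`Scoring/BatchMeansTauIntCLT.lean`).

## Content

* `chain_timeAverage_abs_sub_le_of_envelope` — `E|(1/N) Σ_{t<N} g(X_t) − πg| ≤ √10 (4 C_g A/(1−ρ))/√N`;
* `chain_sampleVariance_abs_sub_le_of_envelope` — `E|v̂_N − Var_π f| ≤ 12 √10 C² A/((1−ρ) √N)`;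
* **`chain_sqrt_mul_sampleVariance_sub_tendstoInMeasure_of_envelope`** — `a_n, b_n → ∞`:
  `√a_n (v̂_{b_n a_n} − Var_π f) → 0` and `v̂_{b_n a_n} → Var_π f` in probability under `P_{μ₀}`.

NOT CLAIMED: almost-sure statements (see `Scoring/BatchMeansTauInt.lean` for the SLLN route under a
minorisation); unbounded `f`.
-/

noncomputable section

namespace Summit.Ventures.LatticeQCDFlow.Scoring

open MeasureTheory ProbabilityTheory Filter Finset Preorder
open scoped ENNReal Topology

variable {Ω : Type*} [MeasurableSpace Ω]

variable {κ : Kernel Ω Ω} [IsMarkovKernel κ] {π : Measure Ω} [IsProbabilityMeasure π] {A ρ : ℝ}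

/-- **Time averages are `√N`-consistent in `L¹` from any start**: envelope `(A, ρ)` (`0 ≤ A`,
`0 ≤ ρ < 1`), `|g| ≤ C_g` measurable, `N ≠ 0`:
`E_{μ₀}|(1/N) Σ_{t<N} g(X_t) − π g| ≤ √10 · (4 C_g A/(1−ρ)) / √N`. -/
theorem chain_timeAverage_abs_sub_le_of_envelope
    (henv : ∀ (g : Ω → ℝ), Measurable g → ∀ (Cg : ℝ), (∀ x, |g x| ≤ Cg) →
      ∀ (t : ℕ) (x : Ω), |(kop κ)^[t] g x - ∫ y, g y ∂π| ≤ 2 * Cg * (A * ρ ^ t))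
    (hA : 0 ≤ A) (hρ0 : 0 ≤ ρ) (hρ1 : ρ < 1)
    {g : Ω → ℝ} (hg : Measurable g) {Cg : ℝ} (hCg : ∀ x, |g x| ≤ Cg)
    (μ₀ : Measure Ω) [IsProbabilityMeasure μ₀] {N : ℕ} (hN : N ≠ 0)
    [IsProbabilityMeasure (Kernel.trajMeasure (X := fun _ : ℕ => Ω) (μ₀)
          (fun n : ℕ => κ.comap (fun h' : (i : ↥(Finset.Iic n)) → Ω => h' ⟨n, Finset.mem_Iic.2 le_rfl⟩)
            (measurable_pi_apply _)))] :
    ∫ x, |(∑ t ∈ Finset.range N, g (x t)) / (N : ℝ) - ∫ z, g z ∂π| ∂(Kernel.trajMeasure (X := fun _ : ℕ => Ω) (μ₀)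
          (fun n : ℕ => κ.comap (fun h' : (i : ↥(Finset.Iic n)) → Ω => h' ⟨n, Finset.mem_Iic.2 le_rfl⟩)
            (measurable_pi_apply _)))
      ≤ Real.sqrt 10 * (4 * Cg * A / (1 - ρ)) / Real.sqrt N := by
  set P := (Kernel.trajMeasure (X := fun _ : ℕ => Ω) (μ₀)
        (fun n : ℕ => κ.comap (fun h' : (i : ↥(Finset.Iic n)) → Ω => h' ⟨n, Finset.mem_Iic.2 le_rfl⟩)
          (measurable_pi_apply _))) with hP
  obtain ⟨x0⟩ := nonempty_of_isProbabilityMeasure μ₀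
  have hCg0 : 0 ≤ Cg := (abs_nonneg _).trans (hCg x0)
  have hK0 : 0 ≤ 4 * Cg * A / (1 - ρ) := div_nonneg (by positivity) (by linarith)
  have hNR : (0 : ℝ) < N := by exact_mod_cast Nat.pos_of_ne_zero hN
  obtain ⟨hgbm, hgb, -⟩ := centred_observable_bounds π hg hCg
  -- the second moment of the centred block sum
  have h2 := chain_blockSum_sq_le_of_envelope (κ := κ) henv hρ0 hρ1 hg hCg μ₀ 0 (n := N) hN
  rw [← hP] at h2
  set K := 4 * Cg * A / (1 - ρ) with hK
  clear_value K
  have hre : ∀ x : ℕ → Ω, (∑ t ∈ Finset.range N, (g (x (0 + t)) - ∫ z, g z ∂π)) / (N : ℝ)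
      = (∑ t ∈ Finset.range N, g (x t)) / (N : ℝ) - ∫ z, g z ∂π := fun x => by
    simp only [zero_add]
    rw [Finset.sum_sub_distrib, sub_div, Finset.sum_const, Finset.card_range, nsmul_eq_mul,
      mul_div_cancel_left₀ _ hNR.ne']
  simp_rw [← hre]
  have hm : Measurable fun x : ℕ → Ω =>
      (∑ t ∈ Finset.range N, (g (x (0 + t)) - ∫ z, g z ∂π)) / (N : ℝ) :=
    (Finset.measurable_sum _ fun t _ => hgbm.comp (measurable_pi_apply _)).div_const _
  have hbd : ∀ x : ℕ → Ω, |(∑ t ∈ Finset.range N, (g (x (0 + t)) - ∫ z, g z ∂π)) / (N : ℝ)|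
      ≤ N * (2 * Cg) / N := fun x => by
    rw [abs_div, abs_of_pos hNR]
    refine div_le_div_of_nonneg_right ((Finset.abs_sum_le_sum_abs _ _).trans ?_) hNR.le
    calc ∑ t ∈ Finset.range N, |g (x (0 + t)) - ∫ z, g z ∂π|
        ≤ ∑ _t ∈ Finset.range N, 2 * Cg := Finset.sum_le_sum fun t _ => hgb _
      _ = N * (2 * Cg) := by rw [Finset.sum_const, Finset.card_range, nsmul_eq_mul]
  -- Jensen: `E|Z| ≤ √(E Z²)`
  have h1 := sq_integral_le_integral_sq P hm.abs (C := N * (2 * Cg) / N)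
    (fun x => by rw [abs_abs]; exact hbd x)
  simp only [sq_abs] at h1
  have hJ : ∫ x, |(∑ t ∈ Finset.range N, (g (x (0 + t)) - ∫ z, g z ∂π)) / (N : ℝ)| ∂P
      ≤ Real.sqrt (∫ x, ((∑ t ∈ Finset.range N, (g (x (0 + t)) - ∫ z, g z ∂π)) / (N : ℝ)) ^ 2 ∂P) :=
    (Real.le_sqrt (integral_nonneg fun x => abs_nonneg _)
      (integral_nonneg fun x => sq_nonneg _)).2 h1
  have h3 : ∫ x, ((∑ t ∈ Finset.range N, (g (x (0 + t)) - ∫ z, g z ∂π)) / (N : ℝ)) ^ 2 ∂P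
      ≤ 10 * K ^ 2 / N := by
    simp_rw [div_pow]
    rw [integral_div, div_le_div_iff₀ (by positivity) hNR]
    have := mul_le_mul_of_nonneg_right h2 hNR.le
    nlinarith [this]
  refine hJ.trans ((Real.sqrt_le_sqrt h3).trans (le_of_eq ?_))
  rw [Real.sqrt_div (by positivity), Real.sqrt_mul (by norm_num), Real.sqrt_sq hK0]

/-- **The sample variance is `√N`-consistent in `L¹` from any start**: envelope `(A, ρ)`,
`|f| ≤ C` measurable, `N ≠ 0`; with `v̂_N = (1/N) Σ_{t<N} f(X_t)² − ((1/N) Σ_{t<N} f(X_t))²`: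
`E_{μ₀}|v̂_N − Var_π f| ≤ 12 √10 C² A / ((1−ρ) √N)`. -/
theorem chain_sampleVariance_abs_sub_le_of_envelope
    (henv : ∀ (g : Ω → ℝ), Measurable g → ∀ (Cg : ℝ), (∀ x, |g x| ≤ Cg) →
      ∀ (t : ℕ) (x : Ω), |(kop κ)^[t] g x - ∫ y, g y ∂π| ≤ 2 * Cg * (A * ρ ^ t))
    (hA : 0 ≤ A) (hρ0 : 0 ≤ ρ) (hρ1 : ρ < 1)
    {f : Ω → ℝ} (hf : Measurable f) {C : ℝ} (hC : ∀ x, |f x| ≤ C)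
    (μ₀ : Measure Ω) [IsProbabilityMeasure μ₀] {N : ℕ} (hN : N ≠ 0)
    [IsProbabilityMeasure (Kernel.trajMeasure (X := fun _ : ℕ => Ω) (μ₀)
          (fun n : ℕ => κ.comap (fun h' : (i : ↥(Finset.Iic n)) → Ω => h' ⟨n, Finset.mem_Iic.2 le_rfl⟩)
            (measurable_pi_apply _)))] :
    ∫ x, |((∑ t ∈ Finset.range N, f (x t) ^ 2) / (N : ℝ) - ((∑ t ∈ Finset.range N, f (x t)) / (N : ℝ)) ^ 2)
        - ∫ z, (f z - ∫ z', f z' ∂π) ^ 2 ∂π| ∂(Kernel.trajMeasure (X := fun _ : ℕ => Ω) (μ₀)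
              (fun n : ℕ => κ.comap (fun h' : (i : ↥(Finset.Iic n)) → Ω => h' ⟨n, Finset.mem_Iic.2 le_rfl⟩)
                (measurable_pi_apply _)))
      ≤ 12 * Real.sqrt 10 * C ^ 2 * A / ((1 - ρ) * Real.sqrt N) := by
  set P := (Kernel.trajMeasure (X := fun _ : ℕ => Ω) (μ₀)
        (fun n : ℕ => κ.comap (fun h' : (i : ↥(Finset.Iic n)) → Ω => h' ⟨n, Finset.mem_Iic.2 le_rfl⟩)
          (measurable_pi_apply _))) with hP
  obtain ⟨x0⟩ := nonempty_of_isProbabilityMeasure μ₀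
  have hC0 : 0 ≤ C := (abs_nonneg _).trans (hC x0)
  have hNR : (0 : ℝ) < N := by exact_mod_cast Nat.pos_of_ne_zero hN
  have hsN : 0 < Real.sqrt N := Real.sqrt_pos.2 hNR
  have hρ' : 0 < 1 - ρ := by linarith
  have hf2 : Measurable fun z => f z ^ 2 := hf.pow_const 2
  have hC2 : ∀ z, |f z ^ 2| ≤ C ^ 2 := fun z => by
    rw [abs_pow]; exact pow_le_pow_left₀ (abs_nonneg _) (hC z) 2
  -- `Var_π f = ∫ f² − (∫ f)²`
  have hi1 : Integrable f π := integrable_of_bounded π hf hC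
  have hi2 : Integrable (fun z => f z ^ 2) π := integrable_of_bounded π hf2 hC2
  have hvar : ∫ z, (f z - ∫ z', f z' ∂π) ^ 2 ∂π = ∫ z, f z ^ 2 ∂π - (∫ z, f z ∂π) ^ 2 := by
    have hpt : ∀ z, (f z - ∫ z', f z' ∂π) ^ 2
        = f z ^ 2 - (2 * ∫ z', f z' ∂π) * f z + (∫ z', f z' ∂π) ^ 2 := fun z => by ring
    have hi3 : Integrable (fun z => f z ^ 2 - (2 * ∫ z', f z' ∂π) * f z) π :=
      hi2.sub (hi1.const_mul _)
    rw [integral_congr_ae (ae_of_all _ hpt), integral_add hi3 (integrable_const _),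
      integral_sub hi2 (hi1.const_mul _), integral_const_mul, integral_const, probReal_univ,
      one_smul]
    ring
  -- the two time averages
  have hT2 := chain_timeAverage_abs_sub_le_of_envelope (κ := κ) henv hA hρ0 hρ1 hf2 hC2 μ₀ hN
  have hT1 := chain_timeAverage_abs_sub_le_of_envelope (κ := κ) henv hA hρ0 hρ1 hf hC μ₀ hN
  rw [← hP] at hT1 hT2
  -- the bound on the sample mean: `|m̂| ≤ C`, `|π f| ≤ C`
  have hmC : |∫ z, f z ∂π| ≤ C := by
    have := centred_observable_bounds π hf hC
    calc |∫ z, f z ∂π| = ‖∫ z, f z ∂π‖ := (Real.norm_eq_abs _).symm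
      _ ≤ C * π.real Set.univ := norm_integral_le_of_norm_le_const (Eventually.of_forall fun z =>
          by rw [Real.norm_eq_abs]; exact hC z)
      _ = C := by rw [probReal_univ, mul_one]
  have hmhC : ∀ x : ℕ → Ω, |(∑ t ∈ Finset.range N, f (x t)) / (N : ℝ)| ≤ C := fun x => by
    rw [abs_div, abs_of_pos hNR, div_le_iff₀ hNR]
    calc |∑ t ∈ Finset.range N, f (x t)| ≤ ∑ t ∈ Finset.range N, |f (x t)| :=
          Finset.abs_sum_le_sum_abs _ _
      _ ≤ ∑ _t ∈ Finset.range N, C := Finset.sum_le_sum fun t _ => hC _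
      _ = C * N := by rw [Finset.sum_const, Finset.card_range, nsmul_eq_mul, mul_comm]
  -- pointwise: `|v̂ − v| ≤ |A₂ − ∫f²| + 2C |A₁ − ∫f|`
  have hpt : ∀ x : ℕ → Ω,
      |((∑ t ∈ Finset.range N, f (x t) ^ 2) / (N : ℝ) - ((∑ t ∈ Finset.range N, f (x t)) / (N : ℝ)) ^ 2)
        - ∫ z, (f z - ∫ z', f z' ∂π) ^ 2 ∂π|
      ≤ |(∑ t ∈ Finset.range N, f (x t) ^ 2) / (N : ℝ) - ∫ z, f z ^ 2 ∂π|
        + 2 * C * |(∑ t ∈ Finset.range N, f (x t)) / (N : ℝ) - ∫ z, f z ∂π| := fun x => by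
    rw [hvar]
    have e : ((∑ t ∈ Finset.range N, f (x t) ^ 2) / (N : ℝ) - ((∑ t ∈ Finset.range N, f (x t)) / (N : ℝ)) ^ 2)
        - (∫ z, f z ^ 2 ∂π - (∫ z, f z ∂π) ^ 2)
        = ((∑ t ∈ Finset.range N, f (x t) ^ 2) / (N : ℝ) - ∫ z, f z ^ 2 ∂π)
          - ((∑ t ∈ Finset.range N, f (x t)) / (N : ℝ) + ∫ z, f z ∂π)
            * ((∑ t ∈ Finset.range N, f (x t)) / (N : ℝ) - ∫ z, f z ∂π) := by ring
    rw [e]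
    refine (abs_sub _ _).trans (add_le_add le_rfl ?_)
    rw [abs_mul]
    refine mul_le_mul_of_nonneg_right ((abs_add_le _ _).trans ?_) (abs_nonneg _)
    linarith [hmhC x, hmC]
  -- integrate
  have hmA1 : Measurable fun x : ℕ → Ω => (∑ t ∈ Finset.range N, f (x t)) / (N : ℝ) - ∫ z, f z ∂π :=
    ((Finset.measurable_sum _ fun t _ => hf.comp (measurable_pi_apply _)).div_const _).sub_const _
  have hmA2 : Measurable fun x : ℕ → Ω =>
      (∑ t ∈ Finset.range N, f (x t) ^ 2) / (N : ℝ) - ∫ z, f z ^ 2 ∂π :=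
    ((Finset.measurable_sum _ fun t _ => hf2.comp (measurable_pi_apply _)).div_const _).sub_const _
  have hbA1 : ∀ x : ℕ → Ω, |(∑ t ∈ Finset.range N, f (x t)) / (N : ℝ) - ∫ z, f z ∂π| ≤ C + C :=
    fun x => (abs_sub _ _).trans (add_le_add (hmhC x) hmC)
  have hm2C : ∀ x : ℕ → Ω, |(∑ t ∈ Finset.range N, f (x t) ^ 2) / (N : ℝ)| ≤ C ^ 2 := fun x => by
    rw [abs_div, abs_of_pos hNR, div_le_iff₀ hNR]
    calc |∑ t ∈ Finset.range N, f (x t) ^ 2| ≤ ∑ t ∈ Finset.range N, |f (x t) ^ 2| :=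
          Finset.abs_sum_le_sum_abs _ _
      _ ≤ ∑ _t ∈ Finset.range N, C ^ 2 := Finset.sum_le_sum fun t _ => hC2 _
      _ = C ^ 2 * N := by rw [Finset.sum_const, Finset.card_range, nsmul_eq_mul, mul_comm]
  have hI2C : |∫ z, f z ^ 2 ∂π| ≤ C ^ 2 := by
    calc |∫ z, f z ^ 2 ∂π| = ‖∫ z, f z ^ 2 ∂π‖ := (Real.norm_eq_abs _).symm
      _ ≤ C ^ 2 * π.real Set.univ := norm_integral_le_of_norm_le_const (Eventually.of_forall fun z =>
          by rw [Real.norm_eq_abs]; exact hC2 z)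
      _ = C ^ 2 := by rw [probReal_univ, mul_one]
  have hbA2 : ∀ x : ℕ → Ω, |(∑ t ∈ Finset.range N, f (x t) ^ 2) / (N : ℝ) - ∫ z, f z ^ 2 ∂π|
      ≤ C ^ 2 + C ^ 2 := fun x => (abs_sub _ _).trans (add_le_add (hm2C x) hI2C)
  have hiA1 : Integrable (fun x : ℕ → Ω =>
      |(∑ t ∈ Finset.range N, f (x t)) / (N : ℝ) - ∫ z, f z ∂π|) P :=
    integrable_of_bounded P hmA1.abs (C := C + C) (fun x => by rw [abs_abs]; exact hbA1 x)
  have hiA2 : Integrable (fun x : ℕ → Ω =>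
      |(∑ t ∈ Finset.range N, f (x t) ^ 2) / (N : ℝ) - ∫ z, f z ^ 2 ∂π|) P :=
    integrable_of_bounded P hmA2.abs (C := C ^ 2 + C ^ 2) (fun x => by rw [abs_abs]; exact hbA2 x)
  have hiS : Integrable (fun x : ℕ → Ω =>
      |(∑ t ∈ Finset.range N, f (x t) ^ 2) / (N : ℝ) - ∫ z, f z ^ 2 ∂π|
        + 2 * C * |(∑ t ∈ Finset.range N, f (x t)) / (N : ℝ) - ∫ z, f z ∂π|) P :=
    hiA2.add (hiA1.const_mul _)
  have hstep : ∫ x, |((∑ t ∈ Finset.range N, f (x t) ^ 2) / (N : ℝ)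
        - ((∑ t ∈ Finset.range N, f (x t)) / (N : ℝ)) ^ 2) - ∫ z, (f z - ∫ z', f z' ∂π) ^ 2 ∂π| ∂P
      ≤ ∫ x, (|(∑ t ∈ Finset.range N, f (x t) ^ 2) / (N : ℝ) - ∫ z, f z ^ 2 ∂π|
        + 2 * C * |(∑ t ∈ Finset.range N, f (x t)) / (N : ℝ) - ∫ z, f z ∂π|) ∂P :=
    integral_mono_of_nonneg (ae_of_all _ fun x => abs_nonneg _) hiS (ae_of_all _ hpt)
  rw [integral_add hiA2 (hiA1.const_mul _), integral_const_mul] at hstep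
  refine hstep.trans ?_
  have e : 12 * Real.sqrt 10 * C ^ 2 * A / ((1 - ρ) * Real.sqrt N)
      = Real.sqrt 10 * (4 * C ^ 2 * A / (1 - ρ)) / Real.sqrt N
        + 2 * C * (Real.sqrt 10 * (4 * C * A / (1 - ρ)) / Real.sqrt N) := by
    field_simp
    ring
  rw [e]
  exact add_le_add hT2 (mul_le_mul_of_nonneg_left hT1 (by positivity))

/-- **`v̂ → Var_π f` and `√a (v̂ − Var_π f) → 0` in probability** along `N_n = b_n a_n` with
`a_n, b_n → ∞` (envelope, any start, `|f| ≤ C` measurable). -/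
theorem chain_sqrt_mul_sampleVariance_sub_tendstoInMeasure_of_envelope
    (henv : ∀ (g : Ω → ℝ), Measurable g → ∀ (Cg : ℝ), (∀ x, |g x| ≤ Cg) →
      ∀ (t : ℕ) (x : Ω), |(kop κ)^[t] g x - ∫ y, g y ∂π| ≤ 2 * Cg * (A * ρ ^ t))
    (hA : 0 ≤ A) (hρ0 : 0 ≤ ρ) (hρ1 : ρ < 1)
    {f : Ω → ℝ} (hf : Measurable f) {C : ℝ} (hC : ∀ x, |f x| ≤ C)
    (μ₀ : Measure Ω) [IsProbabilityMeasure μ₀] {a b : ℕ → ℕ} (ha : Tendsto a atTop atTop)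
    (hb : Tendsto b atTop atTop) [IsProbabilityMeasure (Kernel.trajMeasure (X := fun _ : ℕ => Ω) (μ₀)
          (fun n : ℕ => κ.comap (fun h' : (i : ↥(Finset.Iic n)) → Ω => h' ⟨n, Finset.mem_Iic.2 le_rfl⟩)
            (measurable_pi_apply _)))] :
    TendstoInMeasure (Kernel.trajMeasure (X := fun _ : ℕ => Ω) (μ₀)
          (fun n : ℕ => κ.comap (fun h' : (i : ↥(Finset.Iic n)) → Ω => h' ⟨n, Finset.mem_Iic.2 le_rfl⟩)
            (measurable_pi_apply _))) (fun (n : ℕ) (x : ℕ → Ω) => Real.sqrt (a n) * (((∑ t ∈ Finset.range (b n * a n), f (x t) ^ 2) / ((b n * a n : ℕ) : ℝ) - ((∑ t ∈ Finset.range (b n * a n), f (x t)) / ((b n * a n : ℕ) : ℝ)) ^ 2)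
        - ∫ z, (f z - ∫ z', f z' ∂π) ^ 2 ∂π)) atTop (fun _ => (0 : ℝ))
    ∧ TendstoInMeasure (Kernel.trajMeasure (X := fun _ : ℕ => Ω) (μ₀)
          (fun n : ℕ => κ.comap (fun h' : (i : ↥(Finset.Iic n)) → Ω => h' ⟨n, Finset.mem_Iic.2 le_rfl⟩)
            (measurable_pi_apply _))) (fun (n : ℕ) (x : ℕ → Ω) => ((∑ t ∈ Finset.range (b n * a n), f (x t) ^ 2) / ((b n * a n : ℕ) : ℝ) - ((∑ t ∈ Finset.range (b n * a n), f (x t)) / ((b n * a n : ℕ) : ℝ)) ^ 2)) atTop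
        (fun _ => ∫ z, (f z - ∫ z', f z' ∂π) ^ 2 ∂π) := by
  set P := (Kernel.trajMeasure (X := fun _ : ℕ => Ω) (μ₀)
        (fun n : ℕ => κ.comap (fun h' : (i : ↥(Finset.Iic n)) → Ω => h' ⟨n, Finset.mem_Iic.2 le_rfl⟩)
          (measurable_pi_apply _))) with hP
  set v := ∫ z, (f z - ∫ z', f z' ∂π) ^ 2 ∂π with hv
  have hρ' : 0 < 1 - ρ := by linarith
  have hf2 : Measurable fun z => f z ^ 2 := hf.pow_const 2
  have hVm : ∀ n, Measurable fun x : ℕ → Ω => ((∑ t ∈ Finset.range (b n * a n), f (x t) ^ 2) / ((b n * a n : ℕ) : ℝ) - ((∑ t ∈ Finset.range (b n * a n), f (x t)) / ((b n * a n : ℕ) : ℝ)) ^ 2) := fun n =>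
    ((Finset.measurable_sum _ fun t _ => hf2.comp (measurable_pi_apply _)).div_const _).sub
      (((Finset.measurable_sum _ fun t _ => hf.comp (measurable_pi_apply _)).div_const _).pow_const 2)
  -- eventually `a n ≠ 0`, `b n ≠ 0`
  have hev : ∀ᶠ n in atTop, a n ≠ 0 ∧ b n ≠ 0 :=
    ((ha.eventually (eventually_ne_atTop 0)).and (hb.eventually (eventually_ne_atTop 0)))
  -- the `L¹` bounds
  have hL1 : ∀ n, a n ≠ 0 → b n ≠ 0 →
      ∫ x, |Real.sqrt (a n) * (((∑ t ∈ Finset.range (b n * a n), f (x t) ^ 2) / ((b n * a n : ℕ) : ℝ) - ((∑ t ∈ Finset.range (b n * a n), f (x t)) / ((b n * a n : ℕ) : ℝ)) ^ 2) - v)| ∂P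
        ≤ 12 * Real.sqrt 10 * C ^ 2 * A / (1 - ρ) / Real.sqrt (b n) := fun n han hbn => by
    have hN : b n * a n ≠ 0 := Nat.mul_ne_zero hbn han
    have h1 := chain_sampleVariance_abs_sub_le_of_envelope (κ := κ) henv hA hρ0 hρ1 hf hC μ₀ hN
    rw [← hP] at h1
    have haR : (0 : ℝ) < a n := by exact_mod_cast Nat.pos_of_ne_zero han
    have hbR : (0 : ℝ) < b n := by exact_mod_cast Nat.pos_of_ne_zero hbn
    have hsa : 0 < Real.sqrt (a n) := Real.sqrt_pos.2 haR
    have hsb : 0 < Real.sqrt (b n) := Real.sqrt_pos.2 hbR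
    simp_rw [abs_mul, abs_of_pos hsa]
    rw [integral_const_mul]
    have hsN : Real.sqrt (((b n * a n : ℕ) : ℝ)) = Real.sqrt (b n) * Real.sqrt (a n) := by
      rw [Nat.cast_mul, Real.sqrt_mul hbR.le]
    rw [hsN] at h1
    calc Real.sqrt (a n) * ∫ x, |((∑ t ∈ Finset.range (b n * a n), f (x t) ^ 2) / ((b n * a n : ℕ) : ℝ) - ((∑ t ∈ Finset.range (b n * a n), f (x t)) / ((b n * a n : ℕ) : ℝ)) ^ 2) - v| ∂P
        ≤ Real.sqrt (a n) * (12 * Real.sqrt 10 * C ^ 2 * A / ((1 - ρ) * (Real.sqrt (b n) * Real.sqrt (a n)))) :=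
          mul_le_mul_of_nonneg_left h1 hsa.le
      _ = 12 * Real.sqrt 10 * C ^ 2 * A / (1 - ρ) / Real.sqrt (b n) := by
          field_simp
  -- the right-hand side `→ 0`
  have hK : Tendsto (fun n => 12 * Real.sqrt 10 * C ^ 2 * A / (1 - ρ) / Real.sqrt (b n)) atTop (𝓝 0) := by
    have hsb : Tendsto (fun n => Real.sqrt (b n)) atTop atTop :=
      Real.tendsto_sqrt_atTop.comp (tendsto_natCast_atTop_atTop.comp hb)
    exact hsb.const_div_atTop _
  -- (i) `√a (v̂ − v) → 0` in measure, from `L¹`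
  have h1 : TendstoInMeasure P (fun (n : ℕ) (x : ℕ → Ω) => Real.sqrt (a n) * (((∑ t ∈ Finset.range (b n * a n), f (x t) ^ 2) / ((b n * a n : ℕ) : ℝ) - ((∑ t ∈ Finset.range (b n * a n), f (x t)) / ((b n * a n : ℕ) : ℝ)) ^ 2) - v)) atTop
      (fun _ => (0 : ℝ)) := by
    rw [tendstoInMeasure_iff_measureReal_norm]
    intro δ hδ
    have hmk : ∀ n, a n ≠ 0 → b n ≠ 0 → P.real {x | δ ≤ ‖Real.sqrt (a n) * (((∑ t ∈ Finset.range (b n * a n), f (x t) ^ 2) / ((b n * a n : ℕ) : ℝ) - ((∑ t ∈ Finset.range (b n * a n), f (x t)) / ((b n * a n : ℕ) : ℝ)) ^ 2) - v) - (0 : (ℕ → Ω) → ℝ) x‖}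
        ≤ (12 * Real.sqrt 10 * C ^ 2 * A / (1 - ρ) / Real.sqrt (b n)) / δ := fun n han hbn => by
      have hXm : Measurable fun x : ℕ → Ω => Real.sqrt (a n) * (((∑ t ∈ Finset.range (b n * a n), f (x t) ^ 2) / ((b n * a n : ℕ) : ℝ) - ((∑ t ∈ Finset.range (b n * a n), f (x t)) / ((b n * a n : ℕ) : ℝ)) ^ 2) - v) :=
        ((hVm n).sub_const _).const_mul _
      have hXi : Integrable (fun x : ℕ → Ω => |Real.sqrt (a n) * (((∑ t ∈ Finset.range (b n * a n), f (x t) ^ 2) / ((b n * a n : ℕ) : ℝ) - ((∑ t ∈ Finset.range (b n * a n), f (x t)) / ((b n * a n : ℕ) : ℝ)) ^ 2) - v)|) P := by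
        refine integrable_of_bounded P hXm.abs (C := Real.sqrt (a n) * ((C ^ 2 + C ^ 2) + |v|)) fun x => ?_
        rw [abs_abs, abs_mul, abs_of_nonneg (Real.sqrt_nonneg _)]
        refine mul_le_mul_of_nonneg_left ((abs_sub _ _).trans (add_le_add ?_ le_rfl)) (Real.sqrt_nonneg _)
        have hNR : (0 : ℝ) ≤ ((b n * a n : ℕ) : ℝ) := by positivity
        refine (abs_sub _ _).trans (add_le_add ?_ ?_)
        · rw [abs_div, abs_of_nonneg hNR]
          rcases eq_or_lt_of_le hNR with h0 | hpos
          · rw [← h0, div_zero]; positivity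
          · rw [div_le_iff₀ hpos]
            calc |∑ t ∈ Finset.range (b n * a n), f (x t) ^ 2| ≤ ∑ t ∈ Finset.range (b n * a n), |f (x t) ^ 2| :=
                  Finset.abs_sum_le_sum_abs _ _
              _ ≤ ∑ _t ∈ Finset.range (b n * a n), C ^ 2 := Finset.sum_le_sum fun t _ => by
                  rw [abs_pow]; exact pow_le_pow_left₀ (abs_nonneg _) (hC _) 2
              _ = C ^ 2 * ((b n * a n : ℕ) : ℝ) := by
                  rw [Finset.sum_const, Finset.card_range, nsmul_eq_mul, mul_comm]
        · rw [abs_pow, abs_div, abs_of_nonneg hNR]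
          rcases eq_or_lt_of_le hNR with h0 | hpos
          · rw [← h0, div_zero, zero_pow two_ne_zero]; positivity
          · have : |∑ t ∈ Finset.range (b n * a n), f (x t)| / ((b n * a n : ℕ) : ℝ) ≤ |C| := by
              rw [div_le_iff₀ hpos]
              calc |∑ t ∈ Finset.range (b n * a n), f (x t)| ≤ ∑ t ∈ Finset.range (b n * a n), |f (x t)| :=
                    Finset.abs_sum_le_sum_abs _ _
                _ ≤ ∑ _t ∈ Finset.range (b n * a n), |C| := Finset.sum_le_sum fun t _ =>
                    (hC _).trans (le_abs_self C)
                _ = |C| * ((b n * a n : ℕ) : ℝ) := by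
                    rw [Finset.sum_const, Finset.card_range, nsmul_eq_mul, mul_comm]
            calc (|∑ t ∈ Finset.range (b n * a n), f (x t)| / ((b n * a n : ℕ) : ℝ)) ^ 2 ≤ |C| ^ 2 :=
                  pow_le_pow_left₀ (by positivity) this 2
              _ = C ^ 2 := sq_abs C
      have hset : {x : ℕ → Ω | δ ≤ ‖Real.sqrt (a n) * (((∑ t ∈ Finset.range (b n * a n), f (x t) ^ 2) / ((b n * a n : ℕ) : ℝ) - ((∑ t ∈ Finset.range (b n * a n), f (x t)) / ((b n * a n : ℕ) : ℝ)) ^ 2) - v) - (0 : (ℕ → Ω) → ℝ) x‖}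
          = {x | δ ≤ |Real.sqrt (a n) * (((∑ t ∈ Finset.range (b n * a n), f (x t) ^ 2) / ((b n * a n : ℕ) : ℝ) - ((∑ t ∈ Finset.range (b n * a n), f (x t)) / ((b n * a n : ℕ) : ℝ)) ^ 2) - v)|} := by
        ext x; simp only [Set.mem_setOf_eq, Pi.zero_apply, sub_zero, Real.norm_eq_abs]
      rw [hset, le_div_iff₀ hδ, mul_comm]
      exact (mul_meas_ge_le_integral_of_nonneg (ae_of_all _ fun x => abs_nonneg _) hXi δ).trans
        (hL1 n han hbn)
    refine squeeze_zero' (Eventually.of_forall fun n => measureReal_nonneg)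
      (hev.mono fun n hn => hmk n hn.1 hn.2) ?_
    simpa using hK.div_const δ
  refine ⟨h1, ?_⟩
  -- (ii) `v̂ − v = (√a)⁻¹ · √a (v̂ − v) → 0 · 0`... via the continuous-mapping lemma for products with
  -- a deterministic null sequence: simpler — `L¹` again, without the factor `√a`.
  rw [tendstoInMeasure_iff_measureReal_norm]
  intro δ hδ
  have h1' := (tendstoInMeasure_iff_measureReal_norm.1 h1) δ hδ
  have hev1 : ∀ᶠ n in atTop, 1 ≤ a n := ha.eventually (eventually_ge_atTop 1)
  refine squeeze_zero' (Eventually.of_forall fun n => measureReal_nonneg)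
    (hev1.mono fun n hn => measureReal_mono fun x hx => ?_) h1'
  simp only [Set.mem_setOf_eq, Real.norm_eq_abs, sub_zero] at hx ⊢
  have ha1 : (1 : ℝ) ≤ Real.sqrt (a n) := by
    rw [show (1 : ℝ) = Real.sqrt 1 from Real.sqrt_one.symm]
    exact Real.sqrt_le_sqrt (by exact_mod_cast hn)
  rw [abs_mul, abs_of_nonneg (Real.sqrt_nonneg _)]
  exact hx.trans (le_mul_of_one_le_left (abs_nonneg _) ha1)

end Summit.Ventures.LatticeQCDFlow.Scoring

end
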